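import Mathlib
import Summits.Ventures.HodgeRepro.Tier4.Line1.RTFSetting
import Summits.Ventures.HodgeRepro.Tier4.Line1.KernelSupportFinite
import Summits.Ventures.HodgeRepro.Tier4.Line1.KernelUnfold
import Summits.Ventures.HodgeRepro.Tier4.Line1.KernelOperator
import Summits.Ventures.HodgeRepro.Tier4.Line1.KernelOpEqR
import Summits.Ventures.HodgeRepro.Tier4.Line1.KernelEigen
import Summits.Ventures.HodgeRepro.Tier4.Line1.KernelNondegenerate
import Summits.Ventures.HodgeRepro.Tier4.Line1.InnerCalculus
import Summits.Ventures.HodgeRepro.Tier4.Line1.InnerBridge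
import Summits.Ventures.HodgeRepro.Tier4.Line1.KernelAdjointInner
import Summits.Ventures.HodgeRepro.Tier4.Line1.OrthComplement

/-!
# Tier4/Line1/MaximalFamily — a maximal orthogonal family of irreducible invariant subspaces spans `L²(DG)`;
# it is countable and has a `{0}`-padded enumeration

Blind re-derivation cell `pub-hodge-repro`, Tier 4 «prove the step» (README §9–§10), seat t4-L4-p1 (cross-line J1 glue,
lead S12599).  Tree path `lean/Summits/Ventures/HodgeRepro/Tier4/Line1/MaximalFamily.lean`.  Mathlib-level.

WHAT IS PROVED.  `IsOrthFamily F`: a family of non-zero irreducible invariant subspaces, pairwise `S.inner`-orthogonal.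
Zorn (`exists_maximal_orthFamily`) gives a maximal one, and — with rung (4b) DISPLAYED as a hypothesis — a maximal family
SPANS: every `ψ₀ ∈ L²(DG)` orthogonal to every member of every `V ∈ F` is a.e. zero (`ae_eq_zero_of_orth_maximal`;
otherwise `orthSet F` is a non-zero relatively closed invariant subspace (`OrthComplement`) and (4b) produces a new
irreducible orthogonal to `F`, contradicting maximality).  Also: the zero subspace is an irreducible invariant subspace
orthogonal to everything (the padding of the enumeration).  Every member of an orthogonal family contains a continuous
function of unit `L²(DG)`-norm (`exists_unit_of_isIrrNonzero`); distinct members give orthogonal unit vectors, at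
distance `√2`, so the balls of radius `1/2` around them are pairwise disjoint and the family is COUNTABLE in the
second-countable space `L²(DG)` (`countable_of_isOrthFamily`; `Lp.SecondCountableTopology` for the separable finite
measure `μ|DG` on the countably generated Borel space `G`).  `exists_enumeration` lists a countable family as
`τ : ℕ → Set (G → ℂ)`, replacing repetitions by the zero subspace: every `τ m` is `{0}` or a member, every member
occurs, and `τ m ≠ τ m'` for `m ≠ m'` unless one of them is `{0}`; so `τ` satisfies the first three fields of
`IsAdaptedONB` (`exists_enumeration_orthFamily`).

HC_CM is NOT proved by anyone in this repository.
-/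

set_option autoImplicit false

noncomputable section

namespace Summit.Ventures.HodgeRepro.Tier4.Line1

open MeasureTheory Topology
open scoped ComplexConjugate InnerProductSpace

namespace RTF

variable {G : Type} [Group G] [TopologicalSpace G] [IsTopologicalGroup G] [MeasurableSpace G]
  [BorelSpace G]

namespace Setting

variable (S : Setting G)

/-- `V` is a non-zero irreducible invariant subspace. -/
def IsIrrNonzero (V : Set (G → ℂ)) : Prop :=
  S.IsInvariantSubspace V ∧ S.IsIrreducible V ∧ ∃ ψ ∈ V, ∃ x, ψ x ≠ 0

/-- A family of non-zero irreducible invariant subspaces, pairwise orthogonal. -/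
def IsOrthFamily (F : Set (Set (G → ℂ))) : Prop :=
  (∀ V ∈ F, S.IsIrrNonzero V) ∧ ∀ V ∈ F, ∀ V' ∈ F, V ≠ V' → ∀ ψ ∈ V, ∀ ψ' ∈ V', S.inner ψ ψ' = 0

omit [IsTopologicalGroup G] [BorelSpace G] in
/-- The union of a chain of orthogonal families is an orthogonal family. -/
theorem isOrthFamily_sUnion {c : Set (Set (Set (G → ℂ)))} (hc : IsChain (· ⊆ ·) c)
    (hF : ∀ F ∈ c, S.IsOrthFamily F) : S.IsOrthFamily (⋃₀ c) := by
  refine ⟨fun V hV => ?_, fun V hV V' hV' hne ψ hψ ψ' hψ' => ?_⟩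
  · obtain ⟨F, hFc, hVF⟩ := Set.mem_sUnion.1 hV
    exact (hF F hFc).1 V hVF
  · obtain ⟨F, hFc, hVF⟩ := Set.mem_sUnion.1 hV
    obtain ⟨F', hF'c, hV'F'⟩ := Set.mem_sUnion.1 hV'
    rcases hc.total hFc hF'c with h | h
    · exact (hF F' hF'c).2 V (h hVF) V' hV'F' hne ψ hψ ψ' hψ'
    · exact (hF F hFc).2 V hVF V' (h hV'F') hne ψ hψ ψ' hψ'

omit [IsTopologicalGroup G] [BorelSpace G] in
/-- **Zorn**: there is a maximal orthogonal family. -/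
theorem exists_maximal_orthFamily :
    ∃ F : Set (Set (G → ℂ)), S.IsOrthFamily F ∧ ∀ F', S.IsOrthFamily F' → F ⊆ F' → F' = F := by
  obtain ⟨F, hF⟩ := zorn_subset {F : Set (Set (G → ℂ)) | S.IsOrthFamily F} (fun c hc hchain =>
    ⟨⋃₀ c, isOrthFamily_sUnion S hchain fun F hF => hc hF, fun F hF => Set.subset_sUnion_of_mem hF⟩)
  exact ⟨F, hF.prop, fun F' hF' hsub => (hF.eq_of_subset hF' hsub).symm⟩

omit [IsTopologicalGroup G] [BorelSpace G] in
/-- `S.inner ψ 0 = 0`. -/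
theorem inner_fun_zero_right (ψ : G → ℂ) : S.inner ψ (0 : G → ℂ) = 0 := by
  unfold inner
  simp

omit [IsTopologicalGroup G] [BorelSpace G] in
/-- `S.inner 0 ψ = 0`. -/
theorem inner_fun_zero_left (ψ : G → ℂ) : S.inner (0 : G → ℂ) ψ = 0 := by
  unfold inner
  simp

omit [IsTopologicalGroup G] [BorelSpace G] in
/-- `R f 0 = 0`. -/
theorem R_zero (f : G → ℂ) : S.R f (0 : G → ℂ) = 0 := by
  funext x
  unfold R
  simp

omit [IsTopologicalGroup G] [BorelSpace G] in
/-- **The zero subspace** is an invariant subspace. -/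
theorem isInvariantSubspace_zero : S.IsInvariantSubspace ({0} : Set (G → ℂ)) := by
  refine ⟨?_, ?_, ?_, ?_, ?_, ?_⟩
  · rintro φ hφ
    rw [Set.mem_singleton_iff] at hφ
    subst hφ
    intro γ x
    rfl
  · rintro φ hφ
    rw [Set.mem_singleton_iff] at hφ
    subst hφ
    exact continuous_const
  · rintro φ hφ g
    rw [Set.mem_singleton_iff] at hφ ⊢
    subst hφ
    rfl
  · rintro φ hφ ψ hψ
    rw [Set.mem_singleton_iff] at hφ hψ ⊢
    subst hφ hψ
    funext x
    simp
  · rintro φ hφ c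
    rw [Set.mem_singleton_iff] at hφ ⊢
    subst hφ
    funext x
    simp
  · rintro φ hφ f _
    rw [Set.mem_singleton_iff] at hφ ⊢
    subst hφ
    exact R_zero S f

omit [IsTopologicalGroup G] [BorelSpace G] in
/-- **The zero subspace** is irreducible. -/
theorem isIrreducible_zero : S.IsIrreducible ({0} : Set (G → ℂ)) := by
  intro V' _ hsub
  left
  intro ψ hψ x
  have := hsub hψ
  rw [Set.mem_singleton_iff] at this
  subst this
  rfl

/-- **A maximal orthogonal family spans**, given rung (4b): every `ψ₀ ∈ L²(DG)` orthogonal to all its members is a.e.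
zero. -/
theorem ae_eq_zero_of_orth_maximal [LocallyCompactSpace G] [SecondCountableTopology G]
    (h4b : ∀ V : Set (G → ℂ), S.IsInvariantSubspace V →
      (∀ ψ : G → ℂ, Continuous ψ → S.Invariant ψ →
        (∀ ε : ℝ, 0 < ε → ∃ ψ' ∈ V,
          eLpNorm (fun x => ψ x - ψ' x) 2 (S.μ.restrict S.DG) < ENNReal.ofReal ε) → ψ ∈ V) →
      (∃ ψ ∈ V, ∃ x, ψ x ≠ 0) →
      ∃ V' : Set (G → ℂ), S.IsInvariantSubspace V' ∧ V' ⊆ V ∧ S.IsIrreducible V' ∧ ∃ ψ ∈ V', ∃ x, ψ x ≠ 0)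
    {F : Set (Set (G → ℂ))} (hF : S.IsOrthFamily F) (hmax : ∀ F', S.IsOrthFamily F' → F ⊆ F' → F' = F)
    {ψ₀ : G → ℂ} (hψ₀ : MemLp ψ₀ 2 (S.μ.restrict S.DG)) (horth : ∀ V ∈ F, ∀ w ∈ V, S.inner ψ₀ w = 0) :
    ψ₀ =ᵐ[S.μ.restrict S.DG] 0 := by
  haveI : Countable S.Gk := S.countable_Gk
  by_contra hne
  have hFinv : ∀ V ∈ F, S.IsInvariantSubspace V := fun V hV => (hF.1 V hV).1
  -- `orthSet F` is a non-zero relatively closed invariant subspace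
  obtain ⟨ψ, hψ, hψne⟩ := S.exists_mem_orthSet_ne_zero hFinv hψ₀ hne horth
  obtain ⟨V', hV'inv, hV'sub, hV'irr, hV'ne⟩ := h4b (S.orthSet F) (S.orthSet_isInvariantSubspace hFinv)
    (S.orthSet_relClosed hFinv) ⟨ψ, hψ, hψne⟩
  -- `V'` is orthogonal to every member of `F` (both orders) and not in `F`
  have horthV' : ∀ V ∈ F, ∀ w ∈ V, ∀ ψ' ∈ V', S.inner w ψ' = 0 ∧ S.inner ψ' w = 0 := by
    intro V hV w hw ψ' hψ'
    have h1 : S.inner ψ' w = 0 := (hV'sub hψ').2.2 V hV w hw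
    refine ⟨?_, h1⟩
    rw [S.inner_conj (S.memLp_restrict_of_continuous (hV'sub hψ').1)
      (S.memLp_restrict_of_continuous ((hFinv V hV).cont w hw)), h1, map_zero]
  have hV'notmem : V' ∉ F := by
    intro hmem
    obtain ⟨ψ', hψ', x, hx⟩ := hV'ne
    have h0 : S.inner ψ' ψ' = 0 := (hV'sub hψ').2.2 V' hmem ψ' hψ'
    have := S.eq_zero_of_inner_self_eq_zero (hV'sub hψ').2.1 (hV'sub hψ').1 h0
    exact hx (by rw [this]; rfl)
  -- the enlarged family is an orthogonal family, contradicting maximality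
  have hF' : S.IsOrthFamily (insert V' F) := by
    refine ⟨fun V hV => ?_, fun V hV W hW hne' ψ hψ φ hφ => ?_⟩
    · rcases Set.mem_insert_iff.1 hV with rfl | hV
      · exact ⟨hV'inv, hV'irr, hV'ne⟩
      · exact hF.1 V hV
    · rcases Set.mem_insert_iff.1 hV with hVe | hVF <;> rcases Set.mem_insert_iff.1 hW with hWe | hWF
      · exact absurd (hVe.trans hWe.symm) hne'
      · rw [hVe] at hψ
        exact (horthV' W hWF φ hφ ψ hψ).2
      · rw [hWe] at hφ
        exact (horthV' V hVF ψ hψ φ hφ).1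
      · exact hF.2 V hVF W hWF hne' ψ hψ φ hφ
  have := hmax _ hF' (Set.subset_insert V' F)
  exact hV'notmem (this ▸ Set.mem_insert V' F)


omit [IsTopologicalGroup G] [BorelSpace G] in
/-- The zero function is invariant. -/
theorem invariant_zero : S.Invariant (0 : G → ℂ) := fun _ _ => rfl

/-- A non-zero irreducible invariant subspace contains a continuous function of unit `L²(DG)`-norm. -/
theorem exists_unit_of_isIrrNonzero [SecondCountableTopology G] {V : Set (G → ℂ)} (hV : S.IsIrrNonzero V) :
    ∃ ψ ∈ V, ∃ hψ : Continuous ψ, ‖S.toL2 hψ‖ = 1 := by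
  obtain ⟨hinv, -, ψ₀, hψ₀, x, hx⟩ := hV
  have hc : Continuous ψ₀ := hinv.cont ψ₀ hψ₀
  have hne : S.toL2 hc ≠ 0 := by
    intro h0
    rw [S.toL2_eq_zero_iff] at h0
    haveI : Countable S.Gk := S.countable_Gk
    have := S.eq_of_ae_eq_DG (hinv.inv ψ₀ hψ₀) hc (S.invariant_zero) continuous_const h0
    exact hx (by rw [this]; rfl)
  refine ⟨fun x => (‖S.toL2 hc‖⁻¹ : ℂ) * ψ₀ x, hinv.smul ψ₀ hψ₀ _, continuous_const.mul hc, ?_⟩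
  rw [S.toL2_smul hc]
  exact norm_smul_inv_norm hne

/-- **An orthogonal family is countable** (`L²(DG)` is second countable; orthogonal unit vectors are `√2` apart). -/
theorem countable_of_isOrthFamily [SecondCountableTopology G] {F : Set (Set (G → ℂ))} (hF : S.IsOrthFamily F) :
    F.Countable := by
  haveI := S.isFiniteMeasure_restrict_DG
  haveI : Fact ((2 : ENNReal) ≠ ⊤) := ⟨ENNReal.ofNat_ne_top⟩
  have hchoice : ∀ V : ↥F, ∃ u : Lp ℂ 2 (S.μ.restrict S.DG),
      ‖u‖ = 1 ∧ ∃ ψ ∈ (V : Set (G → ℂ)), ∃ hψ : Continuous ψ, u = S.toL2 hψ := by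
    intro V
    obtain ⟨ψ, hψ, hc, hn⟩ := S.exists_unit_of_isIrrNonzero (hF.1 V V.2)
    exact ⟨S.toL2 hc, hn, ψ, hψ, hc, rfl⟩
  choose u hu hψ using hchoice
  have hdist : ∀ V W : ↥F, V ≠ W → 1 ≤ ‖u V - u W‖ := by
    intro V W hne
    obtain ⟨ψ, hψV, hc, hu1⟩ := hψ V
    obtain ⟨φ, hφW, hc', hu2⟩ := hψ W
    have horth : ⟪u V, u W⟫_ℂ = 0 := by
      rw [hu1, hu2, ← S.inner_eq_inner_toL2 hc' hc]
      exact hF.2 W W.2 V V.2 (fun h => hne (Subtype.ext h.symm)) φ hφW ψ hψV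
    have h2 : ‖u V - u W‖ ^ 2 = 2 := by
      rw [norm_sub_sq (𝕜 := ℂ), horth, map_zero, hu V, hu W]
      norm_num
    nlinarith [norm_nonneg (u V - u W)]
  have hdisj : Pairwise (Function.onFun Disjoint fun V : ↥F => Metric.ball (u V) (1 / 2)) := by
    intro V W hne
    simp only [Function.onFun]
    apply Metric.ball_disjoint_ball
    rw [dist_eq_norm]
    linarith [hdist V W hne]
  haveI : Countable ↥F := hdisj.countable_of_isOpen_disjoint (fun _ => Metric.isOpen_ball)
    (fun _ => Metric.nonempty_ball.2 (by norm_num))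
  exact Set.countable_coe_iff.1 this

omit [Group G] [TopologicalSpace G] [IsTopologicalGroup G] [MeasurableSpace G] [BorelSpace G] in
/-- **Enumeration with `{0}`-padding**: a countable family of sets is listed by some `τ : ℕ → Set (G → ℂ)` whose
values are `{0}` or members, every member occurs, and two distinct indices carry distinct values unless one of them
is `{0}`. -/
theorem exists_enumeration {F : Set (Set (G → ℂ))} (hF : F.Countable) :
    ∃ τ : ℕ → Set (G → ℂ), (∀ m, τ m = {0} ∨ τ m ∈ F) ∧ (∀ V ∈ F, ∃ m, τ m = V) ∧
      ∀ m m', m ≠ m' → τ m ≠ {0} → τ m ≠ τ m' := by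
  obtain ⟨f, hf⟩ := (hF.insert ({0} : Set (G → ℂ))).exists_eq_range ⟨{0}, Set.mem_insert _ _⟩
  refine ⟨fun m => if ∃ m' < m, f m' = f m then {0} else f m, fun m => ?_, fun V hV => ?_, fun m m' hne h0 => ?_⟩
  · by_cases h : ∃ m' < m, f m' = f m
    · simp only [h, if_true, true_or]
    · simp only [h, if_false]
      have : f m ∈ insert ({0} : Set (G → ℂ)) F := hf ▸ Set.mem_range_self m
      exact Set.mem_insert_iff.1 this
  · have hV' : V ∈ Set.range f := hf ▸ Set.mem_insert_of_mem _ hV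
    obtain ⟨m, hm⟩ := hV'
    -- take the least index hitting `V`
    have hex : ∃ m, f m = V := ⟨m, hm⟩
    refine ⟨Nat.find hex, ?_⟩
    have hfind : f (Nat.find hex) = V := Nat.find_spec hex
    have hno : ¬ ∃ m' < Nat.find hex, f m' = f (Nat.find hex) := by
      rintro ⟨m', hlt, heq⟩
      exact Nat.find_min hex hlt (heq.trans hfind)
    beta_reduce
    rw [if_neg hno]
    exact hfind
  · by_cases h : ∃ m' < m, f m' = f m
    · exact absurd (by simp only [h, if_true]) h0
    · simp only [h, if_false] at h0 ⊢
      by_cases h' : ∃ k < m', f k = f m'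
      · simp only [h', if_true]
        exact h0
      · simp only [h', if_false]
        intro heq
        rcases Nat.lt_or_gt_of_ne hne with hlt | hlt
        · exact h' ⟨m, hlt, heq⟩
        · exact h ⟨m', hlt, heq.symm⟩

/-- The `{0}`-padded enumeration of a maximal orthogonal family satisfies the first three fields of `IsAdaptedONB`,
and every member of the family is one of its values. -/
theorem exists_enumeration_orthFamily [SecondCountableTopology G] {F : Set (Set (G → ℂ))}
    (hF : S.IsOrthFamily F) :
    ∃ τ : ℕ → Set (G → ℂ), (∀ m, S.IsInvariantSubspace (τ m)) ∧ (∀ m, S.IsIrreducible (τ m)) ∧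
      (∀ m m', m ≠ m' → ∀ ψ ∈ τ m, ∀ ψ' ∈ τ m', S.inner ψ ψ' = 0) ∧
      (∀ m, τ m = {0} ∨ τ m ∈ F) ∧ (∀ V ∈ F, ∃ m, τ m = V) := by
  obtain ⟨τ, hτ, hall, hinj⟩ := exists_enumeration (S.countable_of_isOrthFamily hF)
  refine ⟨τ, fun m => ?_, fun m => ?_, fun m m' hne ψ hψ ψ' hψ' => ?_, hτ, hall⟩
  · rcases hτ m with h | h
    · rw [h]; exact S.isInvariantSubspace_zero
    · exact (hF.1 _ h).1
  · rcases hτ m with h | h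
    · rw [h]; exact S.isIrreducible_zero
    · exact (hF.1 _ h).2.1
  · rcases hτ m with h | h
    · rw [h, Set.mem_singleton_iff] at hψ
      rw [hψ]
      exact S.inner_fun_zero_left ψ'
    · rcases hτ m' with h' | h'
      · rw [h', Set.mem_singleton_iff] at hψ'
        rw [hψ']
        exact S.inner_fun_zero_right ψ
      · have hne' : τ m ≠ τ m' := by
          apply hinj m m' hne
          intro h0
          obtain ⟨ψ₀, hψ₀, x, hx⟩ := (hF.1 _ h).2.2
          have : ψ₀ ∈ ({0} : Set (G → ℂ)) := h0 ▸ hψ₀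
          rw [Set.mem_singleton_iff] at this
          exact hx (by rw [this]; rfl)
        exact hF.2 _ h _ h' hne' ψ hψ ψ' hψ'

end Setting

end RTF

end Summit.Ventures.HodgeRepro.Tier4.Line1

end
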